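import Summits.CriticalPhenomena.PercolationContinuityZ3.Theorems.PercNearOneGluingNoHeavyLowerTailAntitheticCyclePlusRegroup
import Summits.CriticalPhenomena.PercolationContinuityZ3.Theorems.PercNearOneGluingNoHeavyLowerTailAntitheticChangeCube
import Summits.CriticalPhenomena.PercolationContinuityZ3.Theorems.PercNearOneGluingNoHeavyLowerTailAntitheticIndicator
import HarnessLib

/-!
# `NoHeavyLowerTail` (stmt-CriticalPhenomena-4575) — antithetic cluster pairs: THEOREM C′, ASSEMBLY modulo the boundary count (prim-hp-2 gen 42;
# HOME/THEOREM-Cprime-delta2-cycle.md §7, §12 (L5))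

Support file (`--supports stmt-CriticalPhenomena-4575`, hull-port prover `prim-hp-2`, gen 42).  No definitions, no named facts, no sorries; standard
axioms.

SETTING: `G = H + xy + xz` with `H` the cycle `v 0 = s, …, v (n−1)` (`E = {s(x, v p), s(x, v q)} ∪ Cyc.edgeSet n v`, `x` off the cycle,
`0 < p, q < n`), `x ∈ R ∌ s`.  THEOREM C′ = `0 ≤ CHANGE_G(x; R)` = the change part of `Contract.deg2_decomposition`.  By …ChangeCube it is twice the
lifted half-sum over `D = {ω ∈ tset_{E₀}(R,∅) : xy ∈ ω, xz ∉ ω, ¬(y red-reached ∧ z blue-reached)}`; the BULK part of that sum is `≥ 0`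
(…CyclePlusRegroup `Cyc.Bulk.sum_bulk_nonneg`), and by the indicator reduction (…AntitheticIndicator) the BOUNDARY part is `≥ 0` for all monotone
`F, G` as soon as it is for all pairs of upper-set indicators — the counting lemma BL′ of the theorem file (§6), to be formalised (L4).
* `Antithetic.CyclePlus.notMem_edgeSet_of_mem`, `edgeSet_sdiff_eq`, `deg_two` — `x` off the cycle: its pairs are not cycle pairs, `E ∖ {xy, xz} = E₀`,
  and `x` meets exactly `xy, xz`;
* `Antithetic.CyclePlus.change_nonneg_of_boundary` — **THEOREM C′ modulo BL′**: if the boundary count holds for all upper-set pairs then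
  `0 ≤ Σ_{ω ∈ tset_E(R,∅), xy ≢ xz} Δ_E(F,G)(ω)` for all monotone `F, G` (the hypothesis `hchg` of `Contract.good_of_change_nonneg` with `X = ∅`).
[cite: VandenbergHaggstromKahn2005, §1 p. 3 (open cluster `C_s`)]
-/

noncomputable section

namespace Summit.CriticalPhenomena.PercolationContinuityZ3.Theorems

open Literature.Probability.Percolation
open scoped Classical symmDiff

namespace Antithetic

namespace CyclePlus

variable {V : Type*} {n : ℕ} {v : ℕ → V} (hper : v n = v 0) {x : V} (hx : ∀ i, i < n → v i ≠ x)

include hper hx in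
/-- A pair containing `x` is not a pair of the cycle (`x` is off the cycle). [this work] -/
theorem notMem_edgeSet_of_mem (hn : 0 < n) {g : Sym2 V} (hg : x ∈ g) : g ∉ Cyc.edgeSet n v := by
  rintro ⟨i, hi, rfl⟩
  unfold Cyc.edge at hg
  rcases Sym2.mem_iff.1 hg with h | h
  · exact hx i hi h.symm
  · by_cases hi1 : i + 1 < n
    · exact hx (i + 1) hi1 h.symm
    · have : i + 1 = n := by omega
      rw [this, hper] at h
      exact hx 0 hn h.symm

include hper hx in
/-- `E ∖ {xy, xz} = E₀` for `E = {xy, xz} ∪ E₀`, `x` off the cycle. [this work] -/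
theorem edgeSet_sdiff_eq (hn : 0 < n) (y z : V) :
    (insert s(x, y) (insert s(x, z) (Cyc.edgeSet n v))) \ {s(x, y), s(x, z)} = Cyc.edgeSet n v := by
  ext g
  simp only [Set.mem_sdiff, Set.mem_insert_iff, Set.mem_singleton_iff, not_or]
  constructor
  · rintro ⟨h | h | h, h1, h2⟩
    · exact absurd h h1
    · exact absurd h h2
    · exact h
  · intro h
    refine ⟨Or.inr (Or.inr h), fun h1 => ?_, fun h2 => ?_⟩
    · exact notMem_edgeSet_of_mem hper hx hn (g := g) (h1 ▸ Sym2.mem_mk_left _ _) h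
    · exact notMem_edgeSet_of_mem hper hx hn (g := g) (h2 ▸ Sym2.mem_mk_left _ _) h

include hper hx in
/-- `x` meets exactly the pairs `xy`, `xz` of `E = {xy, xz} ∪ E₀`. [this work] -/
theorem deg_two (hn : 0 < n) (y z : V) :
    ∀ h ∈ insert s(x, y) (insert s(x, z) (Cyc.edgeSet n v)), x ∈ h → h = s(x, y) ∨ h = s(x, z) := by
  rintro h (rfl | rfl | hE) hxh
  · exact Or.inl rfl
  · exact Or.inr rfl
  · exact absurd hE (notMem_edgeSet_of_mem hper hx hn hxh)

variable [Fintype V] (hn : 3 ≤ n) (hinj : ∀ i j, i < n → j < n → v i = v j → i = j)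
include hn hinj hper hx

/-- **THEOREM C′ modulo the boundary count.**  Cycle `v 0 = s, …, v (n−1)`, `x` off the cycle, `y = v p`, `z = v q` (`0 < p, q < n`, `p ≠ q`),
`E = {xy, xz} ∪ E₀`, `x ∈ R ∌ s`.  If the BOUNDARY part of the lifted half change sum is nonnegative for every pair of upper-set indicators
(hypothesis `HB` — the counting lemma BL′, §6 of the theorem file), then the change part of `Contract.deg2_decomposition` at `x` is nonnegative for
all monotone `F, G`: `0 ≤ Σ_{ω ∈ tset_E(R,∅), xy ≢ xz} Δ_E(F,G)(ω)`. [this work] -/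
theorem change_nonneg_of_boundary {p q : ℕ} (hp0 : 0 < p) (hpn : p < n) (hq0 : 0 < q) (hqn : q < n) (hpq : p ≠ q) (R : Set V)
    (hRs : v 0 ∉ R) (hxR : x ∈ R) {F G : Set (Sym2 V) → ℝ} (hF : Monotone F) (hG : Monotone G)
    (HB : ∀ U W : Set (Set (Sym2 V)), IsUpperSet U → IsUpperSet W →
      0 ≤ ∑ ω ∈ ((Peel.tset (Cyc.edgeSet n v) (v 0) R ∅).filter (fun ω => s(x, v p) ∈ ω ∧ s(x, v q) ∉ ω ∧
          ¬ ((openGraph (ω ∩ Cyc.edgeSet n v)).Reachable (v 0) (v p) ∧ (openGraph (ωᶜ ∩ Cyc.edgeSet n v)).Reachable (v 0) (v q)))).filter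
          (fun ω => ¬ (Cyc.Bulk.iLen n v ω + Cyc.Bulk.jLen n v ω + 2 ≤ n)),
        ((if Pendant.liftSet (v 0) (v p) s(x, v p) (openEdgeCluster (ω ∩ Cyc.edgeSet n v) (v 0)) ∈ U then (1 : ℝ) else 0) -
            (if Pendant.liftSet (v 0) (v q) s(x, v q) (openEdgeCluster (ωᶜ ∩ Cyc.edgeSet n v) (v 0)) ∈ U then (1 : ℝ) else 0)) *
          ((if Pendant.liftSet (v 0) (v p) s(x, v p) (openEdgeCluster (ω ∩ Cyc.edgeSet n v) (v 0)) ∈ W then (1 : ℝ) else 0) -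
            (if Pendant.liftSet (v 0) (v q) s(x, v q) (openEdgeCluster (ωᶜ ∩ Cyc.edgeSet n v) (v 0)) ∈ W then (1 : ℝ) else 0))) :
    0 ≤ ∑ ω ∈ (Peel.tset (insert s(x, v p) (insert s(x, v q) (Cyc.edgeSet n v))) (v 0) R ∅).filter
        (fun ω => ¬ (s(x, v p) ∈ ω ↔ s(x, v q) ∈ ω)),
      Peel.delta F G (insert s(x, v p) (insert s(x, v q) (Cyc.edgeSet n v))) (v 0) ω := by
  have hn0 : 0 < n := by omega
  have hxs : x ≠ v 0 := fun h => hx 0 hn0 h.symm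
  have hxy : x ≠ v p := fun h => hx p hpn h.symm
  have hxz : x ≠ v q := fun h => hx q hqn h.symm
  have hyz : v p ≠ v q := fun h => hpq (hinj p q hpn hqn h)
  have he : s(x, v p) ∈ insert s(x, v p) (insert s(x, v q) (Cyc.edgeSet n v)) := Set.mem_insert _ _
  have hf : s(x, v q) ∈ insert s(x, v p) (insert s(x, v q) (Cyc.edgeSet n v)) := Set.mem_insert_of_mem _ (Set.mem_insert _ _)
  have hdeg := deg_two hper hx hn0 (v p) (v q)
  have he0 : s(x, v p) ∉ Cyc.edgeSet n v := notMem_edgeSet_of_mem hper hx hn0 (Sym2.mem_mk_left _ _)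
  have hf0 : s(x, v q) ∉ Cyc.edgeSet n v := notMem_edgeSet_of_mem hper hx hn0 (Sym2.mem_mk_left _ _)
  refine Change.change_nonneg_of_half hxs hxy hxz he hf hdeg F G R ∅ hxR (Set.notMem_empty x) ?_
  rw [edgeSet_sdiff_eq hper hx hn0]
  -- split the half-sum over D into bulk and boundary
  rw [← Finset.sum_filter_add_sum_filter_not _ (fun ω => Cyc.Bulk.iLen n v ω + Cyc.Bulk.jLen n v ω + 2 ≤ n)]
  refine add_nonneg ?_ ?_
  · exact Cyc.Bulk.sum_bulk_nonneg hn hinj hper R hRs hp0 hpn hq0 hqn he0 hf0 hF hG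
  · -- boundary: indicator reduction
    have key := Indicator.form_nonneg_of_upperSet
      (((Peel.tset (Cyc.edgeSet n v) (v 0) R ∅).filter (fun ω => s(x, v p) ∈ ω ∧ s(x, v q) ∉ ω ∧
          ¬ ((openGraph (ω ∩ Cyc.edgeSet n v)).Reachable (v 0) (v p) ∧ (openGraph (ωᶜ ∩ Cyc.edgeSet n v)).Reachable (v 0) (v q)))).filter
          (fun ω => ¬ (Cyc.Bulk.iLen n v ω + Cyc.Bulk.jLen n v ω + 2 ≤ n)))
      (fun _ => (1 : ℝ))
      (fun ω => Pendant.liftSet (v 0) (v p) s(x, v p) (openEdgeCluster (ω ∩ Cyc.edgeSet n v) (v 0)))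
      (fun ω => Pendant.liftSet (v 0) (v q) s(x, v q) (openEdgeCluster (ωᶜ ∩ Cyc.edgeSet n v) (v 0)))
      (fun U W hU hW => ?_) hF hG
    · refine key.trans_eq (Finset.sum_congr rfl fun ω _ => ?_)
      rw [one_mul]
    · refine (HB U W hU hW).trans_eq (Finset.sum_congr rfl fun ω _ => ?_)
      rw [one_mul]

end CyclePlus

end Antithetic

end Summit.CriticalPhenomena.PercolationContinuityZ3.Theorems
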